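import Summits.BirchSwinnertonDyer.BirchSwinnertonDyer.Theorems.AlignedTransportAtTwoMainConjectureOfRankZeroBSDAtTwoCubicSplitStratumRelationMatrixRowN1727
import Summits.BirchSwinnertonDyer.BirchSwinnertonDyer.Theorems.AlignedTransportAtTwoMainConjectureOfRankZeroBSDAtTwoCubicSplitStratumRelationMatrixRow29359b1
import Summits.BirchSwinnertonDyer.BirchSwinnertonDyer.Theorems.AlignedTransportAtTwoMainConjectureOfRankZeroBSDAtTwoCubicSplitStratumRelationMatrixRow29359d1
import Summits.BirchSwinnertonDyer.BirchSwinnertonDyer.Theorems.AlignedTransportAtTwoMainConjectureOfRankZeroBSDAtTwoCubicCarrierRoad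
import HarnessLib

/-!
# Route `AlignedTransportAtTwo`, crux C2 `MainConjectureOfRankZeroBSDAtTwo` (stmt-BirchSwinnertonDyer-22298):
# THE `−1727` ROW, part 3: `μ₂ = 0` UNCONDITIONAL for the three split-stratum seeds `1727a1`, `29359b1`, `29359d1` (the `r = 2` field), and `MC₂(W)`
# at each seed modulo PRINT⁵ + MuIneqʳ + the crux's own hypotheses (att-p5 g24's cubic carrier road with its `μ₂ = 0` input DISCHARGED by the row)

HONEST FRAMING (cell `bsd-f1-sign2`, WIDTH-5 attached prover seat `bsd-line-att-p3` gen 55 on line `birth` of the lead `bsd-line-att-p2`; `--supports`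
stmt-BirchSwinnertonDyer-22298, closes nothing; BSD is NOT proved by any of this; the crux C2, its verdict «blocked-on `Rank1Residual.GreenbergMuConjectureIrreducible`»
and every registered stub are untouched).  THEOREMS ONLY (no `def`, no named fact, no instance, no `sorry`).

WHAT.  For `W ∈ {1727a1 = [1,−1,0,−76,275], 29359b1 = [1,0,1,64629,−11438055], 29359d1 = [1,−1,1,−4578,−131736]}` (all with the cubic `2`-division field of
discriminant `−1727`, good ordinary at `2`, `E[2]` irreducible, `Δ < 0`): `exists_root_twoTorsionPolynomial_W`, ★ `classicalMuVanishes_cubicField_W_unconditional`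
(from the rows `…RowN1727`, `…Row29359b1`, `…Row29359d1`: `rank₂ Cl(K_m) ≤ 2 ∀ m`, `μ₂ = 0`, `λ₂ ≤ 2`), and ★ `mazurMainConjecture_two_W_of_print` — `MazurMainConjecture W 2`
from {`h17` Kato 17.4 at `2`, `hGr` Greenberg 4.1, `hper`, `hmod`, `hGZK`} + `hI` = MuIneqʳ (registered stub of line `birth`, verbatim) + `r_an(W) = 0`, analytic `μ₂ = 0`
on the even branch, `BSD₂(W)` — the crux's own hypotheses at `W` — via `AlignedTransportAtTwoCubicCarrierRoad.mazurMainConjecture_two_of_muIneqRel_of_classicalMu_cubicField_of_Δ_neg`,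
exactly as att-p4 g45's `…RowN7683` §4.  CONDITIONAL (prints + stub + cell hypotheses); BSD is NOT proved; nothing is closed.

References: [Kato2004Asterisque] Thm. 17.4; [GreenbergLNM1716] Thm. 4.1, Conj. 1.11; [Iwasawa1973MuInvariants] Thm. 2, Thm. 3; [Washington1997] §13.3; [CremonaAlgorithms1997] Table 1;
tree: this seat's rows p837898 (1727a1), p838064 (29359b1), p838065 (29359d1), att-p5 g24 `…CubicCarrierRoad`, `ByReductionTypeAtTwoTowerClass{1727a,29359b,29359d}`.
-/

set_option linter.dupNamespace false
set_option autoImplicit false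

noncomputable section

open scoped Classical NumberField nonZeroDivisors IntermediateField

namespace Summit.BirchSwinnertonDyer.BirchSwinnertonDyer.Theorems.AlignedTransportAtTwoCubicSplitStratumRelationMatrixRowN1727

open NumberField IsDedekindDomain Polynomial WeierstrassCurve IntermediateField CongruenceSubgroup Module
  Literature.NumberTheory.IwasawaTheory Literature.NumberTheory.GaloisRepresentations
  Literature.NumberTheory.EllipticCurves Literature.NumberTheory.EllipticCurves.Greenberg1999
  Literature.NumberTheory.EllipticCurves.ModularForms Literature.NumberTheory.EllipticCurves.Rank1Residual Literature.NumberTheory.EllipticCurves.Module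
  Literature.NumberTheory.NumberFields Literature.NumberTheory.CubicFields
  Summit.BirchSwinnertonDyer.Rank1Residual Summit.BirchSwinnertonDyer.Rank1Residual.X1.MuLambda
  Summit.BirchSwinnertonDyer.Rank1Residual.X5 Summit.BirchSwinnertonDyer.Rank1Residual.X5.O1 Summit.BirchSwinnertonDyer.Rank1Residual.X5.Instances
  Summit.BirchSwinnertonDyer.Rank1Residual.F1Sign2 Summit.BirchSwinnertonDyer.BirchSwinnertonDyer.Theorems.Rank1ResidualX1Defs
  Summit.BirchSwinnertonDyer.BirchSwinnertonDyer.Theses.AlignedTransportAtTwo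
  Summit.BirchSwinnertonDyer.BirchSwinnertonDyer.Theorems.TowerClass
  Summit.BirchSwinnertonDyer.BirchSwinnertonDyer.Theorems.AlignedTransportAtTwoCubicCarrierRoad

/-! ## `W = 1727a1` -/

/-- The `2`-division cubic of `1727a1` has a root in `ℚ̄`. [cite: SilvermanAEC2009, III.1] -/
theorem exists_root_twoTorsionPolynomial_1727a1 :
    ∃ β : AlgebraicClosure ℚ, aeval β c1727a1.twoTorsionPolynomial.toPoly = 0 := by
  apply IsAlgClosed.exists_aeval_eq_zero
  rw [Cubic.degree_of_a_ne_zero (by simp [WeierstrassCurve.twoTorsionPolynomial])]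
  decide

/-- ★★ **`μ₂(κ) = 0` — UNCONDITIONAL — for every cyclotomic `ℤ₂`-extension `κ` of `ℚ(β)`, `β` any `2`-division root of `1727a1`** (the cubic field of discriminant
`−1727`), by the two-generator relation-matrix row. [cite: Washington1997, §13.3] [cite: LMFDB, number field 3.1.1727.1] -/
theorem classicalMuVanishes_cubicField_1727a1_unconditional {β : AlgebraicClosure ℚ} (hβ : aeval β c1727a1.twoTorsionPolynomial.toPoly = 0)
    (κP : ZpExtension ↥(IntermediateField.adjoin ℚ ({β} : Set (AlgebraicClosure ℚ))) 2) (hκP : κP.IsCyclotomic) : ClassicalMuVanishes κP :=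
  (classGroupPRank_le_and_mu_lambda_cubicField_1727a1 hβ κP hκP).2.1

/-- ★ **`C2` AT THE SEED `1727a1` modulo PRINT⁵ + MuIneqʳ + the crux's own hypotheses at this `W`** — att-p5 g24's carrier road (`Δ_W < 0`, good ordinary at `2`,
no rational `2`-torsion) with its `μ₂ = 0` input DISCHARGED by the `−1727` row: `MazurMainConjecture W 2` from {`h17` Kato 17.4 at `2`, `hGr` Greenberg 4.1, `hper`,
`hmod`, `hGZK`} + `hI` = MuIneqʳ (registered stub of line `birth`, verbatim) + `r_an(W) = 0`, analytic `μ₂ = 0` on the even branch, `BSD₂(W)`.  CONDITIONAL; BSD is NOT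
proved; nothing is closed. [cite: Kato2004Asterisque, Thm. 17.4 (1)(2) (p. 273)] [cite: GreenbergLNM1716, Thm. 4.1 (p. 102) and Conj. 1.11 (p. 58)]
[cite: Iwasawa1973MuInvariants, Thm. 2 and Thm. 3] -/
theorem mazurMainConjecture_two_1727a1_of_print
    (h17 : ∀ [NeZero (c1727a1.conductorNorm ℤ)] (f : CuspForm (Gamma0 (c1727a1.conductorNorm ℤ)) 2),
      kato_divisibility_allPrimes c1727a1 2 (f := f))
    (hGr : Greenberg1999.thm41_charValue_rankZero_anyPrime)
    (hper : realPeriodRat_eq_unit_mul_plusPeriod_two) (hmod : nonempty_modularParametrizationData)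
    (hGZK : rank_eq_analyticRank_of_analyticRank_le_one)
    (hI : ∀ (W : WeierstrassCurve ℚ) [W.IsElliptic] [W.IsGloballyMinimal], IsOrdinaryAt W 2 →
      (∀ x : ℚ, ¬ HasRationalTwoTorsionX W x) →
      ∀ (κ : ZpExtension ℚ 2) (γ : Field.absoluteGaloisGroup ℚ), κ.IsCyclotomic →
      κ.IsTopGenerator γ → IsCyclotomicVariable 2 γ →
      ∀ ⦃N : ℕ⦄ [NeZero N] (f : CuspForm (Gamma0 N) 2), IsNewformOf W f →
      ∀ Gp : IwasawaAlgebra 2, iwasawaToPowerSeries 2 Gp = padicLFunction f (unitRoot W 2 : ℚ_[2]) →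
      ∀ (D : W.SelmerDualData κ γ) (Yr : W.FineSelmerDualDataRelaxedInf κ γ),
        lengthAt (IwasawaAlgebra 2) D.X ⟨IwasawaAlgebra.augIdealP 2, IwasawaAlgebra.isPrime_augIdealP_holds 2⟩ ≤
          lengthAt (IwasawaAlgebra 2) (IwasawaAlgebra 2 ⧸ Ideal.span {Gp})
              ⟨IwasawaAlgebra.augIdealP 2, IwasawaAlgebra.isPrime_augIdealP_holds 2⟩ +
            lengthAt (IwasawaAlgebra 2) Yr.X ⟨IwasawaAlgebra.augIdealP 2, IwasawaAlgebra.isPrime_augIdealP_holds 2⟩)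
    (hr : c1727a1.analyticRank = 0)
    (hμan : ∀ ⦃N : ℕ⦄ [NeZero N] (f : CuspForm (Gamma0 N) 2), IsNewformOf c1727a1 f →
      ∀ G : IwasawaAlgebra 2, IsEvenBranchLiftAtTwo c1727a1 f G → red G ≠ 0)
    (hbsd : BSDp c1727a1 2) :
    MazurMainConjecture c1727a1 2 := by
  obtain ⟨β, hβ⟩ := exists_root_twoTorsionPolynomial_1727a1
  have hord : IsOrdinaryAt c1727a1 2 := goodOrd_two_1727a1
  exact mazurMainConjecture_two_of_muIneqRel_of_classicalMu_cubicField_of_Δ_neg c1727a1 h17 hGr hper hmod hGZK hI hord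
    not_hasRationalTwoTorsionX_1727a1 Δ_neg_c1727a1 hr hμan hbsd hβ (fun κP hκP =>
      (classGroupPRank_le_and_mu_lambda_cubicField_1727a1 hβ κP hκP).2.1)

/-! ## `W = 29359b1` -/

/-- The `2`-division cubic of `29359b1` has a root in `ℚ̄`. [cite: SilvermanAEC2009, III.1] -/
theorem exists_root_twoTorsionPolynomial_29359b1 :
    ∃ β : AlgebraicClosure ℚ, aeval β c29359b1.twoTorsionPolynomial.toPoly = 0 := by
  apply IsAlgClosed.exists_aeval_eq_zero
  rw [Cubic.degree_of_a_ne_zero (by simp [WeierstrassCurve.twoTorsionPolynomial])]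
  decide

/-- ★★ **`μ₂(κ) = 0` — UNCONDITIONAL — for every cyclotomic `ℤ₂`-extension `κ` of `ℚ(β)`, `β` any `2`-division root of `29359b1`** (the cubic field of discriminant
`−1727`), by the two-generator relation-matrix row. [cite: Washington1997, §13.3] [cite: LMFDB, number field 3.1.1727.1] -/
theorem classicalMuVanishes_cubicField_29359b1_unconditional {β : AlgebraicClosure ℚ} (hβ : aeval β c29359b1.twoTorsionPolynomial.toPoly = 0)
    (κP : ZpExtension ↥(IntermediateField.adjoin ℚ ({β} : Set (AlgebraicClosure ℚ))) 2) (hκP : κP.IsCyclotomic) : ClassicalMuVanishes κP :=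
  (classGroupPRank_le_and_mu_lambda_cubicField_29359b1 hβ κP hκP).2.1

/-- ★ **`C2` AT THE SEED `29359b1` modulo PRINT⁵ + MuIneqʳ + the crux's own hypotheses at this `W`** — att-p5 g24's carrier road (`Δ_W < 0`, good ordinary at `2`,
no rational `2`-torsion) with its `μ₂ = 0` input DISCHARGED by the `−1727` row: `MazurMainConjecture W 2` from {`h17` Kato 17.4 at `2`, `hGr` Greenberg 4.1, `hper`,
`hmod`, `hGZK`} + `hI` = MuIneqʳ (registered stub of line `birth`, verbatim) + `r_an(W) = 0`, analytic `μ₂ = 0` on the even branch, `BSD₂(W)`.  CONDITIONAL; BSD is NOT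
proved; nothing is closed. [cite: Kato2004Asterisque, Thm. 17.4 (1)(2) (p. 273)] [cite: GreenbergLNM1716, Thm. 4.1 (p. 102) and Conj. 1.11 (p. 58)]
[cite: Iwasawa1973MuInvariants, Thm. 2 and Thm. 3] -/
theorem mazurMainConjecture_two_29359b1_of_print
    (h17 : ∀ [NeZero (c29359b1.conductorNorm ℤ)] (f : CuspForm (Gamma0 (c29359b1.conductorNorm ℤ)) 2),
      kato_divisibility_allPrimes c29359b1 2 (f := f))
    (hGr : Greenberg1999.thm41_charValue_rankZero_anyPrime)
    (hper : realPeriodRat_eq_unit_mul_plusPeriod_two) (hmod : nonempty_modularParametrizationData)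
    (hGZK : rank_eq_analyticRank_of_analyticRank_le_one)
    (hI : ∀ (W : WeierstrassCurve ℚ) [W.IsElliptic] [W.IsGloballyMinimal], IsOrdinaryAt W 2 →
      (∀ x : ℚ, ¬ HasRationalTwoTorsionX W x) →
      ∀ (κ : ZpExtension ℚ 2) (γ : Field.absoluteGaloisGroup ℚ), κ.IsCyclotomic →
      κ.IsTopGenerator γ → IsCyclotomicVariable 2 γ →
      ∀ ⦃N : ℕ⦄ [NeZero N] (f : CuspForm (Gamma0 N) 2), IsNewformOf W f →
      ∀ Gp : IwasawaAlgebra 2, iwasawaToPowerSeries 2 Gp = padicLFunction f (unitRoot W 2 : ℚ_[2]) →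
      ∀ (D : W.SelmerDualData κ γ) (Yr : W.FineSelmerDualDataRelaxedInf κ γ),
        lengthAt (IwasawaAlgebra 2) D.X ⟨IwasawaAlgebra.augIdealP 2, IwasawaAlgebra.isPrime_augIdealP_holds 2⟩ ≤
          lengthAt (IwasawaAlgebra 2) (IwasawaAlgebra 2 ⧸ Ideal.span {Gp})
              ⟨IwasawaAlgebra.augIdealP 2, IwasawaAlgebra.isPrime_augIdealP_holds 2⟩ +
            lengthAt (IwasawaAlgebra 2) Yr.X ⟨IwasawaAlgebra.augIdealP 2, IwasawaAlgebra.isPrime_augIdealP_holds 2⟩)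
    (hr : c29359b1.analyticRank = 0)
    (hμan : ∀ ⦃N : ℕ⦄ [NeZero N] (f : CuspForm (Gamma0 N) 2), IsNewformOf c29359b1 f →
      ∀ G : IwasawaAlgebra 2, IsEvenBranchLiftAtTwo c29359b1 f G → red G ≠ 0)
    (hbsd : BSDp c29359b1 2) :
    MazurMainConjecture c29359b1 2 := by
  obtain ⟨β, hβ⟩ := exists_root_twoTorsionPolynomial_29359b1
  have hord : IsOrdinaryAt c29359b1 2 := goodOrd_two_29359b1
  exact mazurMainConjecture_two_of_muIneqRel_of_classicalMu_cubicField_of_Δ_neg c29359b1 h17 hGr hper hmod hGZK hI hord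
    not_hasRationalTwoTorsionX_29359b1 Δ_neg_c29359b1 hr hμan hbsd hβ (fun κP hκP =>
      (classGroupPRank_le_and_mu_lambda_cubicField_29359b1 hβ κP hκP).2.1)

/-! ## `W = 29359d1` -/

/-- The `2`-division cubic of `29359d1` has a root in `ℚ̄`. [cite: SilvermanAEC2009, III.1] -/
theorem exists_root_twoTorsionPolynomial_29359d1 :
    ∃ β : AlgebraicClosure ℚ, aeval β c29359d1.twoTorsionPolynomial.toPoly = 0 := by
  apply IsAlgClosed.exists_aeval_eq_zero
  rw [Cubic.degree_of_a_ne_zero (by simp [WeierstrassCurve.twoTorsionPolynomial])]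
  decide

/-- ★★ **`μ₂(κ) = 0` — UNCONDITIONAL — for every cyclotomic `ℤ₂`-extension `κ` of `ℚ(β)`, `β` any `2`-division root of `29359d1`** (the cubic field of discriminant
`−1727`), by the two-generator relation-matrix row. [cite: Washington1997, §13.3] [cite: LMFDB, number field 3.1.1727.1] -/
theorem classicalMuVanishes_cubicField_29359d1_unconditional {β : AlgebraicClosure ℚ} (hβ : aeval β c29359d1.twoTorsionPolynomial.toPoly = 0)
    (κP : ZpExtension ↥(IntermediateField.adjoin ℚ ({β} : Set (AlgebraicClosure ℚ))) 2) (hκP : κP.IsCyclotomic) : ClassicalMuVanishes κP :=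
  (classGroupPRank_le_and_mu_lambda_cubicField_29359d1 hβ κP hκP).2.1

/-- ★ **`C2` AT THE SEED `29359d1` modulo PRINT⁵ + MuIneqʳ + the crux's own hypotheses at this `W`** — att-p5 g24's carrier road (`Δ_W < 0`, good ordinary at `2`,
no rational `2`-torsion) with its `μ₂ = 0` input DISCHARGED by the `−1727` row: `MazurMainConjecture W 2` from {`h17` Kato 17.4 at `2`, `hGr` Greenberg 4.1, `hper`,
`hmod`, `hGZK`} + `hI` = MuIneqʳ (registered stub of line `birth`, verbatim) + `r_an(W) = 0`, analytic `μ₂ = 0` on the even branch, `BSD₂(W)`.  CONDITIONAL; BSD is NOT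
proved; nothing is closed. [cite: Kato2004Asterisque, Thm. 17.4 (1)(2) (p. 273)] [cite: GreenbergLNM1716, Thm. 4.1 (p. 102) and Conj. 1.11 (p. 58)]
[cite: Iwasawa1973MuInvariants, Thm. 2 and Thm. 3] -/
theorem mazurMainConjecture_two_29359d1_of_print
    (h17 : ∀ [NeZero (c29359d1.conductorNorm ℤ)] (f : CuspForm (Gamma0 (c29359d1.conductorNorm ℤ)) 2),
      kato_divisibility_allPrimes c29359d1 2 (f := f))
    (hGr : Greenberg1999.thm41_charValue_rankZero_anyPrime)
    (hper : realPeriodRat_eq_unit_mul_plusPeriod_two) (hmod : nonempty_modularParametrizationData)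
    (hGZK : rank_eq_analyticRank_of_analyticRank_le_one)
    (hI : ∀ (W : WeierstrassCurve ℚ) [W.IsElliptic] [W.IsGloballyMinimal], IsOrdinaryAt W 2 →
      (∀ x : ℚ, ¬ HasRationalTwoTorsionX W x) →
      ∀ (κ : ZpExtension ℚ 2) (γ : Field.absoluteGaloisGroup ℚ), κ.IsCyclotomic →
      κ.IsTopGenerator γ → IsCyclotomicVariable 2 γ →
      ∀ ⦃N : ℕ⦄ [NeZero N] (f : CuspForm (Gamma0 N) 2), IsNewformOf W f →
      ∀ Gp : IwasawaAlgebra 2, iwasawaToPowerSeries 2 Gp = padicLFunction f (unitRoot W 2 : ℚ_[2]) →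
      ∀ (D : W.SelmerDualData κ γ) (Yr : W.FineSelmerDualDataRelaxedInf κ γ),
        lengthAt (IwasawaAlgebra 2) D.X ⟨IwasawaAlgebra.augIdealP 2, IwasawaAlgebra.isPrime_augIdealP_holds 2⟩ ≤
          lengthAt (IwasawaAlgebra 2) (IwasawaAlgebra 2 ⧸ Ideal.span {Gp})
              ⟨IwasawaAlgebra.augIdealP 2, IwasawaAlgebra.isPrime_augIdealP_holds 2⟩ +
            lengthAt (IwasawaAlgebra 2) Yr.X ⟨IwasawaAlgebra.augIdealP 2, IwasawaAlgebra.isPrime_augIdealP_holds 2⟩)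
    (hr : c29359d1.analyticRank = 0)
    (hμan : ∀ ⦃N : ℕ⦄ [NeZero N] (f : CuspForm (Gamma0 N) 2), IsNewformOf c29359d1 f →
      ∀ G : IwasawaAlgebra 2, IsEvenBranchLiftAtTwo c29359d1 f G → red G ≠ 0)
    (hbsd : BSDp c29359d1 2) :
    MazurMainConjecture c29359d1 2 := by
  obtain ⟨β, hβ⟩ := exists_root_twoTorsionPolynomial_29359d1
  have hord : IsOrdinaryAt c29359d1 2 := goodOrd_two_29359d1
  exact mazurMainConjecture_two_of_muIneqRel_of_classicalMu_cubicField_of_Δ_neg c29359d1 h17 hGr hper hmod hGZK hI hord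
    not_hasRationalTwoTorsionX_29359d1 Δ_neg_c29359d1 hr hμan hbsd hβ (fun κP hκP =>
      (classGroupPRank_le_and_mu_lambda_cubicField_29359d1 hβ κP hκP).2.1)

end Summit.BirchSwinnertonDyer.BirchSwinnertonDyer.Theorems.AlignedTransportAtTwoCubicSplitStratumRelationMatrixRowN1727

end
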